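import Summits.ResolutionOfSingularities.ResolutionOfSingularities.Theorems.MarkedTransferCampaignW24ReducedRun
import HarnessLib

/-!
# THE DEPTH-`ℓ` REDUCED `γ_*`-RUN IS THE TRUNCATION OF ONE DEPTH-FREE UNIVERSAL RUN — digits, universality, exhaustion criterion
# (HIRONAKA-L, §9 kernel support for the OURS target L-47B-s1 «bottom-member re-run», slot W2.4; reduced model of PREREG-K24 §B7;
# companion of `MarkedTransferCampaignW24ReducedRun.lean`)

**HONEST FRAMING.** OURS throughout (see `MarkedTransferCampaignW24ReducedRun.lean`): kernel theorems about the one-variable reduced model of the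
cell's kill test K2.4 (run/shared/lean/pub/res-hironaka/L/k24/). Nothing below is a statement of [Hironaka2017] (lit key
`paper:url-3343fd9e678b`), nothing asserts that any statement of it holds, nothing is a claim about resolution of singularities in
characteristic `p`; the manuscript stays «under review» (D-0012/D-0089). AI work, weaker than expert review.

## What is proved (`K` a field of characteristic `p`, `P = p^L`)

* **(D) digits** `digit_le_of_not_dvd_choose` (Lucas, digitwise), `exists_order_stepI` / `exists_order_univStepI`: a non-exhausting
  in-box step raises the bottom digit STRICTLY, `k ↦ k′ > k`, with the base-`p` digits of `k` bounded pointwise by those of `k′`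
  (`p = 2`: the bit-set strictly grows).
* `canonStepI P` / `canonRun P G₀` — the canonical (= the only legal, `eq_inv_of_mul_eq_one`) reduced Case-(I) run at depth `P`;
  `univStep` / `univRun g₀` — the UNIVERSAL run: the unit-free step iterated in `K⟦t⟧` with NO modulus.
* **(B) universality** `eqBelow_canonRun_univRun`: if `G₀ ≡ g₀ (mod t^P)` and the universal run stays in the box (`ord γ_j < P`,
  `j < i`), then `G_j ≡ γ_j (mod t^P)` for all `j ≤ i` and the bottom digits agree (`order_canonRun_eq`). So the digit sequence
  `k_*(0) < k_*(1) < …` that K2.4 / res-type-059's W24-explore tables report depth by depth is ONE depth-free sequence per carrier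
  read through the window `k < p^L`; the exhausting depths of a reduced carrier are `{L : p^L − 1 is a universal digit}` (plus early
  deaths of the run), which is the structure behind «ω₂³/(1+ω₁²+ω₁⁶) escapes exactly at ℓ ≡ 0 (mod 3)» (res-type-059 2026-08-27T06:29:37Z)
  and reduces the typed (c3) `CampaignW24.ExhaustsAtSomeDepth` on reduced carriers to «`p^L − 1` is a universal digit for
  infinitely many `L`».
* **exhaustion from a universal digit** `canonRun_succ_eq_zero_of_univDigit`: if `ord γ_i = P − 1` (in box before), the canonical
  depth-`P` run is EXHAUSTED at state `i + 1`: `G_{i+1} = 0` exactly.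
Hypotheses: each theorem's own binders; no FACT-LIST fact, no DEFECT binder. Written by res-D-pv-035 AS res-L1-k24. Standard axioms.
-/

noncomputable section

set_option linter.dupNamespace false -- mandated namespace of this single-conjunct summit

namespace Summit.ResolutionOfSingularities.ResolutionOfSingularities.Theorems

namespace CampaignW24

namespace ReducedRun

open PowerSeries
open Literature.RingTheory.MvPowerSeries (hasseDeriv coeff_hasseDeriv IsSupportedOnMultiples)

universe u

variable {A : Type u} [CommRing A]

/-! ## The Case-(III) first step (bottom digit `k = 0`) -/

/-- [OURS · L W2.4 reduced model] The **reduced Case-(III) step** `G ↦ G − w^{M−1}·G^M` (PREREG-K24 §B7: `H^{red}(G) = u_*^{−(2^{q+1}−1)}·G^{2^{q+1}}`,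
`M = 2^{q+1}`; the normalisation exponent is R102(β)'s, OURS). [folklore] -/
def stepIII (w : A⟦X⟧) (M : ℕ) (G : A⟦X⟧) : A⟦X⟧ := G - w ^ (M - 1) * G ^ M

/-- [OURS · L W2.4 reduced model] The **universal Case-(III) step** `g ↦ g − b^{M−1}·g^M` (`b` an inverse of `g(0)`). OURS. [folklore] -/
def univStepIII (b : A) (M : ℕ) (g : A⟦X⟧) : A⟦X⟧ := g - C (b ^ (M - 1)) * g ^ M

/-- **AUTONOMY (A), Case (III).** `stepIII w M G ≡ univStepIII (w(0)) M g (mod t^P)` whenever `w·u = 1` for the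
class-`0` part `u = unitPart P 0 G` and `g ≡ G`. [folklore] -/
theorem eqBelow_stepIII_univStepIII {P M : ℕ} {w G g : A⟦X⟧} (hw : w * unitPart P 0 G = 1)
    (hGg : EqBelow P G g) : EqBelow P (stepIII w M G) (univStepIII (constantCoeff w) M g) := by
  unfold stepIII univStepIII
  have hw' : EqBelow P w (C (constantCoeff w)) :=
    eqBelow_C_of_isSupportedOnMultiples
      (isSupportedOnMultiples_of_mul_eq_one (isSupportedOnMultiples_unitPart _ _ _) hw)
  have hpow : EqBelow P (w ^ (M - 1)) (C (constantCoeff w ^ (M - 1))) := by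
    rw [map_pow]; exact hw'.pow _
  exact hGg.sub (hpow.mul (hGg.pow M))



/-! ## Digits (D): the bottom exponent rises strictly, base-`p` digitwise -/

/-- **Lucas, digitwise**: if `p ∤ C(n, k)` then every base-`p` digit of `k` is at most the corresponding
digit of `n`. [folklore] -/
theorem digit_le_of_not_dvd_choose {p : ℕ} [hp : Fact p.Prime] :
    ∀ (j : ℕ) {n k : ℕ}, ¬ p ∣ n.choose k → k / p ^ j % p ≤ n / p ^ j % p
  | 0, n, k, h => by
    rw [pow_zero, Nat.div_one, Nat.div_one]
    by_contra hlt
    push Not at hlt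
    apply h
    have hl := Choose.choose_modEq_choose_mod_mul_choose_div_nat (n := n) (k := k) (p := p)
    rw [Nat.choose_eq_zero_of_lt hlt, zero_mul] at hl
    exact Nat.modEq_zero_iff_dvd.mp hl
  | j + 1, n, k, h => by
    have hl := Choose.choose_modEq_choose_mod_mul_choose_div_nat (n := n) (k := k) (p := p)
    have h' : ¬ p ∣ (n / p).choose (k / p) := by
      intro hd
      apply h
      exact Nat.modEq_zero_iff_dvd.mp (hl.trans (Nat.modEq_zero_iff_dvd.mpr (dvd_mul_of_dvd_right hd _)))
    have ih := digit_le_of_not_dvd_choose j h'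
    rwa [Nat.div_div_eq_div_mul, Nat.div_div_eq_div_mul, ← pow_succ'] at ih

section Order

variable {K : Type u} [Field K] (p : ℕ) [hp : Fact p.Prime] [CharP K p]

/-- **Order of the step shape** `c·G·D^{(k)}F` (`c(0) ≠ 0`, `ord G = k`, `coeff_k F = 0`): if it is nonzero its
order `k′` exceeds `k` and dominates `k` base-`p` digitwise (`C(k′, k) ≢ 0 mod p`). Both the reduced and the
universal Case-(I) steps have this shape. [folklore] -/
theorem exists_order_mul_mul_D {c G F : K⟦X⟧} {k : ℕ} (hc : constantCoeff c ≠ 0) (hG : order G = k)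
    (hF : coeff k F = 0) (hne : c * (G * D k F) ≠ 0) :
    ∃ k' : ℕ, order (c * (G * D k F)) = k' ∧ k < k' ∧ ∀ j, k / p ^ j % p ≤ k' / p ^ j % p := by
  have hR : D k F ≠ 0 := fun h => hne (by rw [h, mul_zero, mul_zero])
  obtain ⟨m, hm⟩ : ∃ m : ℕ, order (D k F) = m :=
    ENat.ne_top_iff_exists.mp (fun h => hR (order_eq_top.mp h)) |>.imp fun m hm => hm.symm
  have hc0 : order c = 0 := by
    rw [← Nat.cast_zero, order_eq_nat]
    exact ⟨by rwa [coeff_zero_eq_constantCoeff_apply], fun i hi => absurd hi (Nat.not_lt_zero i)⟩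
  refine ⟨k + m, ?_, ?_, ?_⟩
  · rw [order_mul, order_mul, hc0, hG, hm, zero_add, Nat.cast_add]
  · have hm0 : m ≠ 0 := by
      rintro rfl
      have h0 := (order_eq_nat.mp hm).1
      rw [coeff_D, zero_add, hF, mul_zero] at h0
      exact h0 rfl
    omega
  · intro j
    have hmc := (order_eq_nat.mp hm).1
    rw [coeff_D] at hmc
    have hnd : ¬ p ∣ (m + k).choose k := fun hd =>
      hmc (by rw [(CharP.cast_eq_zero_iff K p _).mpr hd, zero_mul])
    have := digit_le_of_not_dvd_choose (p := p) j hnd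
    rwa [add_comm] at this

/-- **DIGITS (D) for the reduced step.** If `ord G = k < p^L`, `w·u_* = 1` and the step is not exhausted, then
`ord(stepI w k G) = k′ > k` with the base-`p` digits of `k` bounded by those of `k′` pointwise (for `p = 2`: the
bit-set of the bottom digit strictly GROWS). OURS (reduced model). [folklore] -/
theorem exists_order_stepI {L k : ℕ} (hk : k < p ^ L) {w G : K⟦X⟧} (hw : w * unitPart (p ^ L) k G = 1)
    (hG : order G = k) (hne : stepI w k G ≠ 0) :
    ∃ k' : ℕ, order (stepI w k G) = k' ∧ k < k' ∧ ∀ j, k / p ^ j % p ≤ k' / p ^ j % p := by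
  rw [stepI_eq_neg p hk hw] at hne ⊢
  rw [order_neg]
  refine exists_order_mul_mul_D p ?_ hG ?_ (fun h => hne (by rw [h, neg_zero]))
  · intro h0
    have h := congr_arg constantCoeff hw
    rw [map_mul, h0, zero_mul, map_one] at h
    exact zero_ne_one h
  · rw [map_sub, coeff_classPart, if_pos rfl, sub_self]

/-- **DIGITS (D) for the universal step.** Same conclusion for `univStepI b k g` (`b ≠ 0`, `ord g = k`). [folklore] -/
theorem exists_order_univStepI {k : ℕ} {b : K} (hb : b ≠ 0) {g : K⟦X⟧} (hg : order g = k)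
    (hne : univStepI b k g ≠ 0) :
    ∃ k' : ℕ, order (univStepI b k g) = k' ∧ k < k' ∧ ∀ j, k / p ^ j % p ≤ k' / p ^ j % p := by
  unfold univStepI at hne ⊢
  rw [order_neg]
  refine exists_order_mul_mul_D p (by rwa [constantCoeff_C]) hg ?_ (fun h => hne (by rw [h, neg_zero]))
  rw [map_sub, coeff_C_mul, coeff_X_pow, if_pos rfl, mul_one, sub_self]

end Order

/-! ## The canonical depth-`P` run and the universal run (over a field) -/

section Runs

variable {K : Type u} [Field K]

/-- [OURS · L W2.4 reduced model] The **canonical reduced Case-(I) step at depth `P`**: `w := (unitPart P k G)⁻¹`, `k := ord G` (the ONLY legal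
choice: `w·u_* = 1` forces `w = u_*⁻¹`, `eq_inv_of_mul_unitPart_eq_one`). OURS. [folklore] -/
def canonStepI (P : ℕ) (G : K⟦X⟧) : K⟦X⟧ := stepI (unitPart P (order G).toNat G)⁻¹ (order G).toNat G

/-- [OURS · L W2.4 reduced model] The **universal Case-(I) step**: `univStepI` with `k := ord g`, `b := (coeff_k g)⁻¹`. OURS. [folklore] -/
def univStep (g : K⟦X⟧) : K⟦X⟧ := univStepI (coeff (order g).toNat g)⁻¹ (order g).toNat g

/-- [OURS · L W2.4 reduced model] The **canonical depth-`P` Case-(I) run** from `G₀`. OURS. [folklore] -/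
def canonRun (P : ℕ) (G₀ : K⟦X⟧) : ℕ → K⟦X⟧
  | 0 => G₀
  | i + 1 => canonStepI P (canonRun P G₀ i)

/-- [OURS · L W2.4 reduced model] The **universal (depth-free) Case-(I) run** from `G₀`: ONE sequence in `K⟦t⟧`, no modulus. OURS. [folklore] -/
def univRun (G₀ : K⟦X⟧) : ℕ → K⟦X⟧
  | 0 => G₀
  | i + 1 => univStep (univRun G₀ i)

/-- A legal inverse IS the canonical one: `w·u = 1` with `u(0) ≠ 0` forces `w = u⁻¹`. [folklore] -/
theorem eq_inv_of_mul_eq_one {w u : K⟦X⟧} (hu : constantCoeff u ≠ 0) (hw : w * u = 1) : w = u⁻¹ :=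
  (PowerSeries.eq_inv_iff_mul_eq_one hu).mpr hw

/-- The canonical inverse is legal when the bottom coefficient is visible: `ord G = k` gives
`(unitPart P k G)⁻¹ · unitPart P k G = 1`. [folklore] -/
theorem inv_unitPart_mul {P k : ℕ} {G : K⟦X⟧} (hG : order G = k) :
    (unitPart P k G)⁻¹ * unitPart P k G = 1 :=
  PowerSeries.inv_mul_cancel _ (by rw [constantCoeff_unitPart]; exact (order_eq_nat.mp hG).1)

variable (p : ℕ) [hp : Fact p.Prime] [CharP K p]

/-- **UNIVERSALITY (B), one step.** If `ord G = k < p^L` and `g ≡ G (mod t^{p^L})`, the canonical depth-`p^L` step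
and the universal step agree modulo `t^{p^L}`. OURS. [folklore] -/
theorem eqBelow_canonStepI_univStep {L k : ℕ} (hk : k < p ^ L) {G g : K⟦X⟧} (hG : order G = k)
    (hGg : EqBelow (p ^ L) G g) : EqBelow (p ^ L) (canonStepI (p ^ L) G) (univStep g) := by
  have hg : order g = k := hGg.order_eq_of_lt hk hG
  unfold canonStepI univStep
  rw [hG, hg, ENat.toNat_coe]
  have h := eqBelow_stepI_univStepI p hk (inv_unitPart_mul hG) hGg
  rwa [constantCoeff_inv, constantCoeff_unitPart, hGg k hk] at h

/-- **UNIVERSALITY (B).** If `G₀ ≡ g₀ (mod t^{p^L})` and the universal run from `g₀` stays in the box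
(`ord γ_j < p^L` for `j < i`), then the canonical depth-`p^L` run from `G₀` agrees with it modulo `t^{p^L}`:
`G_j ≡ γ_j` for all `j ≤ i`. So the bottom digits `k_*(j)` at EVERY depth are read off ONE depth-free sequence.
OURS (reduced model of PREREG-K24 §B7). [folklore] -/
theorem eqBelow_canonRun_univRun {L : ℕ} {G₀ g₀ : K⟦X⟧} (h0 : EqBelow (p ^ L) G₀ g₀) :
    ∀ i : ℕ, (∀ j < i, ∃ k : ℕ, order (univRun g₀ j) = k ∧ k < p ^ L) →
      EqBelow (p ^ L) (canonRun (p ^ L) G₀ i) (univRun g₀ i)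
  | 0, _ => h0
  | i + 1, hbox => by
    have ih := eqBelow_canonRun_univRun h0 i fun j hj => hbox j (Nat.lt_succ_of_lt hj)
    obtain ⟨k, hk, hkP⟩ := hbox i (Nat.lt_succ_self i)
    exact eqBelow_canonStepI_univStep p hkP (ih.symm.order_eq_of_lt hkP hk) ih

/-- **BOX DIGITS AGREE.** Under the same hypotheses the canonical run has the universal run's bottom digit at
state `i` whenever that digit is in the box. [folklore] -/
theorem order_canonRun_eq {L : ℕ} {G₀ g₀ : K⟦X⟧} (h0 : EqBelow (p ^ L) G₀ g₀) (i : ℕ)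
    (hbox : ∀ j < i, ∃ k : ℕ, order (univRun g₀ j) = k ∧ k < p ^ L) {k : ℕ}
    (hk : order (univRun g₀ i) = k) (hkP : k < p ^ L) : order (canonRun (p ^ L) G₀ i) = k :=
  (eqBelow_canonRun_univRun p h0 i hbox).symm.order_eq_of_lt hkP hk

/-- **EXHAUSTION FROM A UNIVERSAL DIGIT.** If `G₀ ≡ g₀ (mod t^{p^L})`, the universal run from `g₀` stays in the
box before state `i`, and its bottom digit at state `i` is the boundary digit `p^L − 1`, then the canonical
depth-`p^L` run from `G₀` is EXHAUSTED at state `i + 1`: `G_{i+1} = 0` exactly (not merely `≡ 0`). OURS; the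
all-depth mechanism behind K24-REPORT F1/F4. [folklore] -/
theorem canonRun_succ_eq_zero_of_univDigit {L : ℕ} {G₀ g₀ : K⟦X⟧} (h0 : EqBelow (p ^ L) G₀ g₀) (i : ℕ)
    (hbox : ∀ j < i, ∃ k : ℕ, order (univRun g₀ j) = k ∧ k < p ^ L)
    (hdig : order (univRun g₀ i) = (p ^ L - 1 : ℕ)) : canonRun (p ^ L) G₀ (i + 1) = 0 := by
  have hP : 0 < p ^ L := pow_pos hp.out.pos L
  have hord : order (canonRun (p ^ L) G₀ i) = (p ^ L - 1 : ℕ) :=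
    order_canonRun_eq p h0 i hbox hdig (Nat.sub_lt hP one_pos)
  show canonStepI (p ^ L) (canonRun (p ^ L) G₀ i) = 0
  unfold canonStepI
  rw [hord, ENat.toNat_coe]
  exact stepI_eq_zero_of_boundary p (Nat.sub_add_cancel hP) (inv_unitPart_mul hord)

end Runs

end ReducedRun

end CampaignW24

end Summit.ResolutionOfSingularities.ResolutionOfSingularities.Theorems

end
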